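import Summits.AnomalousDissipation.AnomalousDissipation.Theorems.BaireTransferDenseLoudDesignerForcesErgodicLine
import Literature.Analysis.FluidPDE.LerayHopfUniformEnergy
import HarnessLib

/-!
# Stub `stub_phaseMeans` of the line `SketchIdeator2` (card `separatrix-flux-pinning`)
# (crux `MarginalStabilityChain.ChainRealisation`, stmt-AnomalousDissipation-14249)

Sorry-free discharge of the registered stub `stub_phaseMeans` (E1c) of the lead's skeleton: along a phase
trajectory `t ↦ φ t x` of an NS phase `(K, φ)` represented by slices `w t` (`rep (φ t x) = w t` a.e. on `T³`
for `t ≥ 0`), the trajectory time means of the phase,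
`energyAvg φ x T = T⁻¹ ∫₀ᵀ ‖φ t x‖²` and `dissipAvg ν φ x T = T⁻¹ ∫₀ᵀ ν · enstrophyObs (φ t x)`,
ARE the Cesàro means `timeMean g T = T⁻¹ ∫₀ᵀ g` of `t ↦ ∫ ‖w t‖²` and `t ↦ ν (eGradNormSq (w t)).toReal`
(the integrands of `meanEnergy w` / `meanDissipation ν w`).

**Proof.**  Pointwise in `t ≥ 0`:
* the `H`-norm of a state is the `L²`-norm of its class, whose square is the integral of the squared norm of
  ANY representative (`Torus.integral_norm_sq_eq_norm_lift_sq`, i.e. `Torus.integral_norm_sq_coe_eq` and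
  `integral_congr_ae`);
* the spectral enstrophy `eGradNormSq` is defined through Fourier coefficients (Bochner integrals), hence
  depends only on the a.e. class (`Torus.eGradNormSq_coe_lift`).
For `0 ≤ T` the interval integrals over `0..T` only see `t ∈ uIcc 0 T = Icc 0 T ⊆ Ici 0`
(`intervalIntegral.integral_congr`).  The hypotheses `IsNSPhase ν F K φ`, `x ∈ K` and the smoothness of the
slices are not needed.

References: C. Foias, O. Manley, R. Rosa, R. Temam, *Navier–Stokes Equations and Turbulence* (CUP 2001),
Ch. IV §1–2 (time averages along trajectories in `H`); C. R. Doering, C. Foias, *Energy dissipation in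
body-forced turbulence*, J. Fluid Mech. 467 (2002) §2.
-/

set_option linter.dupNamespace false

noncomputable section

open MeasureTheory Set Filter Topology
open scoped InnerProductSpace
open Literature.Analysis.FunctionSpaces Literature.Analysis.FunctionSpaces.Torus
open Literature.Analysis.FluidPDE

namespace Summit.AnomalousDissipation.AnomalousDissipation.Theorems.ChainRealisation.SeparatrixFluxPinning

open Summit.AnomalousDissipation.AnomalousDissipation.Theorems.DenseLoudDesignerForces.Ergodic
open Literature.Analysis.FluidPDE.Torus

/-- Local notation: the torus `T³`. -/
local notation "𝕋³" => UnitAddTorus (Fin 3)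
/-- Local notation: velocity values. -/
local notation "E³" => EuclideanSpace ℝ (Fin 3)
/-- Local notation: the planar torus `T²`. -/
local notation "𝕋²" => UnitAddTorus (Fin 2)
/-- Local notation: planar velocity values. -/
local notation "E²" => EuclideanSpace ℝ (Fin 2)

/-! ## Pointwise identities along a represented trajectory -/

/-- The representation hypothesis `rep (φ t x) =ᵐ w t` (`t ≥ 0`) in the form used by the tree's lift lemmas
(`rep v` is by definition the coercion of the `L²` class of `v` to a function). -/
theorem coe_coe_ae_eq_of_rep {φ : ℝ → Hsp → Hsp} {x : Hsp} {w : ℝ → 𝕋³ → E³}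
    (hrep : ∀ t : ℝ, 0 ≤ t → rep (φ t x) =ᵐ[volume] w t) :
    ∀ t : ℝ, 0 ≤ t →
      (((φ t x : Hsp) : Lp E³ 2 (volume : Measure 𝕋³)) : 𝕋³ → E³) =ᵐ[volume] w t :=
  fun t ht => hrep t ht

/-- **Energy of a represented state**: `‖φ t x‖² = ∫ ‖w t‖²` when `rep (φ t x) = w t` a.e. (the `H`-norm is
the `L²`-norm of the class, `Submodule.coe_norm`, and `Torus.integral_norm_sq_eq_norm_lift_sq`). -/
theorem norm_sq_eq_integral_of_rep {φ : ℝ → Hsp → Hsp} {x : Hsp} {w : ℝ → 𝕋³ → E³}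
    (hrep : ∀ t : ℝ, 0 ≤ t → rep (φ t x) =ᵐ[volume] w t) {t : ℝ} (ht : 0 ≤ t) :
    ‖φ t x‖ ^ 2 = ∫ y, ‖w t y‖ ^ 2 := by
  rw [integral_norm_sq_eq_norm_lift_sq (coe_coe_ae_eq_of_rep hrep) ht, Submodule.coe_norm]

/-- **Enstrophy of a represented state**: `enstrophyObs (φ t x) = (eGradNormSq (w t)).toReal` when
`rep (φ t x) = w t` a.e. (the spectral enstrophy only sees Fourier coefficients, `Torus.eGradNormSq_coe_lift`). -/
theorem enstrophyObs_eq_of_rep {φ : ℝ → Hsp → Hsp} {x : Hsp} {w : ℝ → 𝕋³ → E³}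
    (hrep : ∀ t : ℝ, 0 ≤ t → rep (φ t x) =ᵐ[volume] w t) {t : ℝ} (ht : 0 ≤ t) :
    enstrophyObs (φ t x) = (eGradNormSq (w t)).toReal := by
  unfold enstrophyObs rep
  rw [eGradNormSq_coe_lift (coe_coe_ae_eq_of_rep hrep) ht]

/-! ## The stub -/

/-- Stub E1c (S–M) **PHASE MEANS**: along a phase trajectory represented by classical slices `w t` (`t ≥ 0`), the
trajectory time means of the phase (`energyAvg`, `dissipAvg`, built from the `H`-norm and the spectral enstrophy of
a representative) ARE the Cesàro means entering `meanEnergy` / `meanDissipation` of `w` (the `L²` norm of a class is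
the integral of any representative; `eGradNormSq` depends only on the a.e. class; `timeMean` only sees `t ∈ [0,T]`).
The phase hypotheses and the smoothness of the slices are not used. -/
theorem stub_phaseMeans :
    ∀ (ν : ℝ) (F : 𝕋³ → E³) (K : Set Hsp) (φ : ℝ → Hsp → Hsp) (x : Hsp) (w : ℝ → 𝕋³ → E³),
      IsNSPhase ν F K φ → x ∈ K → (∀ t : ℝ, 0 ≤ t → IsSmooth (w t)) →
      (∀ t : ℝ, 0 ≤ t → rep (φ t x) =ᵐ[volume] w t) →
      (∀ T : ℝ, 0 ≤ T → energyAvg φ x T = timeMean (fun t => ∫ y, ‖w t y‖ ^ 2) T) ∧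
      (∀ T : ℝ, 0 ≤ T → dissipAvg ν φ x T = timeMean (fun t => ν * (eGradNormSq (w t)).toReal) T) := by
  intro ν F K φ x w _hK _hx _hsm hrep
  refine ⟨fun T hT => ?_, fun T hT => ?_⟩
  · unfold energyAvg timeMean
    congr 1
    refine intervalIntegral.integral_congr fun t ht => ?_
    rw [uIcc_of_le hT] at ht
    exact norm_sq_eq_integral_of_rep hrep ht.1
  · unfold dissipAvg timeMean
    congr 1
    refine intervalIntegral.integral_congr fun t ht => ?_
    rw [uIcc_of_le hT] at ht
    show ν * enstrophyObs (φ t x) = ν * (eGradNormSq (w t)).toReal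
    rw [enstrophyObs_eq_of_rep hrep ht.1]

end Summit.AnomalousDissipation.AnomalousDissipation.Theorems.ChainRealisation.SeparatrixFluxPinning

end
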